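/-
Copyright: lit-balaban cell (HOME `run/shared/lean/pub/lit-balaban/`), Phase-2 proof seat p12 (gen 7).  The proofs reproduce the
printed arguments; nothing is claimed beyond what the kernel checks below.
-/
import Literature.MathematicalPhysics.QuantumFieldTheory.DybalskiStottmeisterTanimoto2024.DST24TangentSpace

/-!
# `DybalskiStottmeisterTanimoto2024.DST24CriticalPoint` — [DybalskiStottmeisterTanimoto2024] **§3.3 «Derivation of the critical
# point equation»** PROVED up to display (second-equation-critical): `∂`, `∂*`, `Δ_Ω = −∂*∂`, the functional `𝒜′`, `𝒲(b)`, `W⃗`,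
# `r⃗`, the Lie derivative (3.15)–(3.17) `𝓛_X𝒜′ = 2Σ_x X⃗(x)·(∂*W⃗)(x)`, Proposition (conservation-prop) and (3.14)–(3.14′):
# at a constrained critical point `R̄(x)*(−∂*W⃗)(x) = C⃗(y_x)` is block-constant, i.e. `Δ_Ω A⃗ − ∂*r⃗ = R* C⃗`

statement-level skeleton of published theorems with citation tags; proofs where landed; nothing here is a claim about
the Yang–Mills mass gap

W. Dybalski, A. Stottmeister, Y. Tanimoto, *The Bałaban variational problem in the non-linear sigma model*, Rev. Math. Phys.
**36** (2024), arXiv:2403.09800; source held `paper:arxiv-2403.09800` (§3.3 = tex chunks p0009–p0010).  Unit `lit-balaban-p12`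
(gen 7); dictionary in `DST24Setting`/`DST24TangentSpace` (`A⃗ = vecOf U′`, flow generators `ξ` with `X⃗ = vecOf ξ = −ξ`,
`R = R_{A⃗}`, `R*`, `R̄`).

WHAT IS PRINTED (§3.3) AND PROVED HERE.
* (derivative) «`(∂f)(b) := f(b₋) − f(b₊)`», (adjoint) «`⟨∂f, g⟩_{Ω′} = ⟨f, ∂*g⟩_Ω`», «`(∂*f)(x) = Σ_{b∋x} σ_b(x) f(b)`», (Laplacian)
  «`Δ_Ω := −∂*∂` … satisfies `⟨f, (−Δ_Ω)f⟩ = Σ_{b∈Ω′} ⟨∂f(b), ∂f(b)⟩`» — `del`, `delStar` (with the sign `σ_b(b₋) = +1`, `σ_b(b₊) = −1`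
  forced by the adjoint relation), `ipB`, `ipB_del` (∂* IS the adjoint), `laplace`, `ipS_neg_laplace`.
* (action-one-x′) «`𝒜′(U′) = Σ_b Re Tr(1 − U′(b₋)∂V(y_b)U′(b₊)*)`, `∂V(y_b) := V(y_{b₋})V(y_{b₊})*`» — `pdV`, `Wq`, `actionP`,
  `action_eq_actionP` (`𝒜(U) = 𝒜′(U′)` for `U = U′V`).
* Definition (W-def) «`𝒲(b) := U′(b₋)∂V(y_b)U′(b₊)* = δ_W 𝒲₀(b) + iW⃗(b)·σ⃗`», «`W⃗(b) =: ∂A⃗(b) + r⃗_{A⃗}(b)`» — `Wvec`, `Avec`,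
  `rvec`, `Wvec_eq_del_add_rvec`.
* (3.15)–(3.17) «`𝓛_X(𝒜′) = Σ_b Im Tr(X(b₋)𝒲(b) − 𝒲(b)X(b₊)) = 2Σ_b (∂X_k)(b)W_k(b) = 2Σ_x X_k(x)(∂*W_k)(x)`» —
  `hasDerivAt_actionP_flow`, `lieDeriv_actionP` (`= −2⟨ξ, ∂*W⃗⟩_Ω = 2⟨X⃗, ∂*W⃗⟩_Ω`), `lieDeriv_action`.
* (constraint-tangent-vectors)/Proposition (conservation-prop) «`A⃗` is a critical point of the action in `𝔘_ε(Ω)` with the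
  constraint iff `R̄(c₋)*∂*W⃗(c₋) = R̄(c₊)*∂*W⃗(c₊)` for any bond `c ∈ T(y)`» — proved in the pairwise form (the tangent vector
  `(…, R̄(x)v⃗, …, −R̄(x′)v⃗, …)` is tangent for ANY two sites `x, x′` of one block, not only tree bonds, so no spanning tree is
  needed): `Phi` (`Φ(x) := R̄(x)*(−∂*W⃗)(x)`, (3.14)), `Xpair`, `isTangent_Xpair`, `conservation_prop`
  (critical ⇔ `Φ` constant on blocks), `conservation_on_block_bonds` ((3.10) for every intra-block bond, in particular tree bonds).
* (3.14)–(3.14′), (second-equation-critical) «`R̄(x)*(−∂*W⃗)(x) = C⃗(y_x)` … `−∂*W⃗ = R*C⃗` … `(Δ_Ω A⃗)(x) − (∂*r⃗)(x) = R(x)*C⃗(y_x)`» —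
  `critical_iff_exists_blockConst`, `second_equation_critical`; and «the constraint has the form `Q(A⃗) = 0`» — `Q_Avec_eq_zero`.
  The Green-function form (3.13)/(intermediate-equation) needs `Γ = (−Δ_Ω + Q*Q)⁻¹` (Lemma (inverse-lemma)) and the inverse of
  `QΓR*Q*` (Lemma (Q-G-R-Q-lemma), §4) — next file.
Supporting algebra for `R̄* = (R*)⁻¹`: `SpolyStar`, `RstarBar` with `Rstar_RstarBar`/`RstarBar_Rstar` and `inner_Rbar_left`
(`R̄*` IS `(R*)⁻¹`). [cite: DybalskiStottmeisterTanimoto2024, §3.2 («their inverses»), §3.3]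
-/

namespace Literature.MathematicalPhysics.QuantumFieldTheory.DybalskiStottmeisterTanimoto2024.DST24CriticalPoint

open scoped Quaternion RealInnerProductSpace BigOperators
open Literature.MathematicalPhysics.QuantumFieldTheory.Federbush1986
open Literature.MathematicalPhysics.QuantumFieldTheory.DybalskiStottmeisterTanimoto2024.DST24Setting
open Literature.MathematicalPhysics.QuantumFieldTheory.DybalskiStottmeisterTanimoto2024.DST24Configurations
open Literature.MathematicalPhysics.QuantumFieldTheory.DybalskiStottmeisterTanimoto2024.DST24LinearConstraint
open Literature.MathematicalPhysics.QuantumFieldTheory.DybalskiStottmeisterTanimoto2024.DST24TangentSpace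

noncomputable section

variable {L n₁ : ℕ}

/-! ## Quaternion tools -/

/-- The Euclidean scalar product of `ℍ ≅ ℝ⁴` in coordinates. [cite: DybalskiStottmeisterTanimoto2024, Notation («`⟨f,g⟩`»)] -/
theorem inner_eq_components (p q : ℍ) : ⟪p, q⟫ = p.re * q.re + p.imI * q.imI + p.imJ * q.imJ + p.imK * q.imK := by
  rw [Quaternion.inner_def, Quaternion.re_mul]
  simp only [Quaternion.re_star, Quaternion.imI_star, Quaternion.imJ_star, Quaternion.imK_star]
  ring

/-- `Re(ξw) = ⟨ξ, W⃗⟩` for an imaginary `ξ` (`W⃗ = vecOf w`): the step «`(X⃗·σ⃗)(Y⃗·σ⃗) = (X⃗·Y⃗) + i(X⃗×Y⃗)·σ⃗` and the Pauli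
matrices are traceless» of (3.17). [cite: DybalskiStottmeisterTanimoto2024, §3.3 proof of Proposition (conservation-prop), (3.17)] -/
theorem re_coe_mul_eq_inner (ξ : su2) (w : ℍ) : ((ξ : ℍ) * w).re = ⟪ξ, vecOf w⟫ := by
  rw [Submodule.coe_inner, vecOf_coe, inner_eq_components, Quaternion.re_mul]
  have hξ := su2.re_coe ξ
  simp only [Quaternion.re_neg, Quaternion.imI_neg, Quaternion.imJ_neg, Quaternion.imK_neg, Quaternion.re_im,
    Quaternion.imI_im, Quaternion.imJ_im, Quaternion.imK_im, hξ]
  ring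

/-- `Re(wξ) = ⟨ξ, W⃗⟩` likewise. [cite: DybalskiStottmeisterTanimoto2024, §3.3 (3.17)] -/
theorem re_mul_coe_eq_inner (w : ℍ) (ξ : su2) : (w * ξ).re = ⟪ξ, vecOf w⟫ := by
  rw [Submodule.coe_inner, vecOf_coe, inner_eq_components, Quaternion.re_mul]
  have hξ := su2.re_coe ξ
  simp only [Quaternion.re_neg, Quaternion.imI_neg, Quaternion.imJ_neg, Quaternion.imK_neg, Quaternion.re_im,
    Quaternion.imI_im, Quaternion.imJ_im, Quaternion.imK_im, hξ]
  ring

/-! ## `R̄* = (R*)⁻¹` (supporting §3.2 algebra used in (3.12)–(3.14)) -/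

/-- `S* := 1 + A₀[A⃗×] + [A⃗×]²`, the adjoint of `S = 1 − A₀[A⃗×] + [A⃗×]²` (`[A⃗×]` is skew). [cite: DybalskiStottmeisterTanimoto2024, §3.2 (R-star), (3.1′)] -/
def SpolyStar (A : su2) : su2 →ₗ[ℝ] su2 := LinearMap.id + A0 A • crossLin A + (crossLin A).comp (crossLin A)

/-- `S* v = v + A₀ A⃗×v + A⃗×(A⃗×v)`. [cite: DybalskiStottmeisterTanimoto2024, §3.2 (3.1′)] -/
theorem SpolyStar_apply (A v : su2) : SpolyStar A v = v + A0 A • crossLin A v + crossLin A (crossLin A v) := rfl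

/-- `R*(S* v) = A₀ v`. [cite: DybalskiStottmeisterTanimoto2024, §3.2 (R-star), (3.1′)] -/
theorem Rstar_SpolyStar (A : su2) (h : A0 A ≠ 0) (v : su2) : Rstar A (SpolyStar A v) = A0 A • v := by
  have hn : ‖A‖ ^ 2 = 1 - A0 A * A0 A := by rw [← sq, A0_sq A h]; ring
  simp only [SpolyStar_apply, Rstar_apply, map_add, map_smul, crossLin_crossLin_crossLin, hn]
  module

/-- `S*(R* v) = A₀ v`. [cite: DybalskiStottmeisterTanimoto2024, §3.2 (R-star), (3.1′)] -/
theorem SpolyStar_Rstar (A : su2) (h : A0 A ≠ 0) (v : su2) : SpolyStar A (Rstar A v) = A0 A • v := by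
  have hn : ‖A‖ ^ 2 = 1 - A0 A * A0 A := by rw [← sq, A0_sq A h]; ring
  simp only [Rstar_apply, SpolyStar_apply, map_sub, map_smul, crossLin_crossLin_crossLin, hn]
  module

/-- `R̄* := A₀⁻¹ S* = (R*)⁻¹` (the map `R̄(x)*` of (3.10)–(3.14)). [cite: DybalskiStottmeisterTanimoto2024, §3.3 (3.10), (3.14)] -/
def RstarBar (A : su2) : su2 →ₗ[ℝ] su2 := (A0 A)⁻¹ • SpolyStar A

/-- `R* R̄* = 1` (`A₀ ≠ 0`). [cite: DybalskiStottmeisterTanimoto2024, §3.3 (3.14)→(3.14′) («multiplying by `R(x)*`»)] -/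
theorem Rstar_RstarBar (A : su2) (h : A0 A ≠ 0) (v : su2) : Rstar A (RstarBar A v) = v := by
  rw [RstarBar, LinearMap.smul_apply, map_smul, Rstar_SpolyStar A h, smul_smul, inv_mul_cancel₀ h, one_smul]

/-- `R̄* R* = 1` (`A₀ ≠ 0`). [cite: DybalskiStottmeisterTanimoto2024, §3.3 (3.14)] -/
theorem RstarBar_Rstar (A : su2) (h : A0 A ≠ 0) (v : su2) : RstarBar A (Rstar A v) = v := by
  rw [RstarBar, LinearMap.smul_apply, SpolyStar_Rstar A h, smul_smul, inv_mul_cancel₀ h, one_smul]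

/-- `S`, `S*` as quaternions (for the adjointness computation). [cite: DybalskiStottmeisterTanimoto2024, §3.2 (3.1′)] -/
theorem Spoly_coe (A v : su2) : ((Spoly A v : su2) : ℍ) =
    (v : ℍ) - A0 A • ((A : ℍ) * v).im + ((A : ℍ) * ((A : ℍ) * v).im).im := rfl

/-- `S*` as a quaternion. [cite: DybalskiStottmeisterTanimoto2024, §3.2 (3.1′)] -/
theorem SpolyStar_coe (A v : su2) : ((SpolyStar A v : su2) : ℍ) =
    (v : ℍ) + A0 A • ((A : ℍ) * v).im + ((A : ℍ) * ((A : ℍ) * v).im).im := rfl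

/-- `⟨S v, w⟩ = ⟨v, S* w⟩`. [cite: DybalskiStottmeisterTanimoto2024, §3.2 (R-star) («using `w⃗·(A⃗×v⃗) = −(A⃗×w⃗)·v⃗`»)] -/
theorem inner_Spoly_left (A v w : su2) : ⟪Spoly A v, w⟫ = ⟪v, SpolyStar A w⟫ := by
  rw [Submodule.coe_inner, Submodule.coe_inner, Spoly_coe, SpolyStar_coe, inner_eq_components, inner_eq_components]
  have hA := su2.re_coe A
  have hv := su2.re_coe v
  have hw := su2.re_coe w
  simp only [Quaternion.re_im, Quaternion.imI_im, Quaternion.imJ_im, Quaternion.imK_im,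
    Quaternion.imI_mul, Quaternion.imJ_mul, Quaternion.imK_mul, Quaternion.re_add, Quaternion.imI_add, Quaternion.imJ_add,
    Quaternion.imK_add, Quaternion.re_sub, Quaternion.imI_sub, Quaternion.imJ_sub, Quaternion.imK_sub, Quaternion.re_smul,
    Quaternion.imI_smul, Quaternion.imJ_smul, Quaternion.imK_smul, smul_eq_mul, hA, hv, hw]
  ring

/-- `R̄` as a quaternion. [cite: DybalskiStottmeisterTanimoto2024, §3.2 (3.1′)] -/
theorem Rbar_coe (A v : su2) : ((Rbar A v : su2) : ℍ) = (A0 A)⁻¹ • ((Spoly A v : su2) : ℍ) := rfl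

/-- `R̄*` as a quaternion. [cite: DybalskiStottmeisterTanimoto2024, §3.3 (3.14)] -/
theorem RstarBar_coe (A v : su2) : ((RstarBar A v : su2) : ℍ) = (A0 A)⁻¹ • ((SpolyStar A v : su2) : ℍ) := rfl

/-- `⟨R̄ v, w⟩ = ⟨v, R̄* w⟩`: `RstarBar = (R*)⁻¹` IS the adjoint `R̄*` of `R̄` written in (3.10)–(3.14).
[cite: DybalskiStottmeisterTanimoto2024, §3.3 (3.12) («`−2v⃗_c·(R̄(c₋)*∂*W⃗(c₋) − R̄(c₊)*∂*W⃗(c₊))`»)] -/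
theorem inner_Rbar_left (A v w : su2) : ⟪Rbar A v, w⟫ = ⟪v, RstarBar A w⟫ := by
  have h := inner_Spoly_left A v w
  rw [Submodule.coe_inner, Submodule.coe_inner] at h
  rw [Submodule.coe_inner, Submodule.coe_inner, Rbar_coe, RstarBar_coe, real_inner_smul_left, real_inner_smul_right, h]

/-! ## (derivative), (adjoint), (Laplacian): `∂`, `∂*`, `Δ_Ω = −∂*∂` -/

section Lattice

variable {M : Type*} [AddCommGroup M]

/-- (derivative) «`(∂f)(b) := f(b₋) − f(b₊)`», `∂ : 𝓛²(Ω) → 𝓛²(Ω′)`. [cite: DybalskiStottmeisterTanimoto2024, §3.3 (derivative)] -/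
def del (f : Site L n₁ → M) (b : Bond L n₁) : M := f b.src - f b.tgt

/-- `(∂f)(b) = f(b₋) − f(b₊)`. [cite: DybalskiStottmeisterTanimoto2024, §3.3 (derivative)] -/
theorem del_apply (f : Site L n₁ → M) (b : Bond L n₁) : del f b = f b.src - f b.tgt := rfl

/-- (adjoint), explicit form «`(∂*f)(x) = Σ_{b∋x} σ_b(x) f(b)`»: `+f(b)` for the bonds `b` starting at `x` (`b₋ = x`) and `−f(b)`
for those ending at `x` (`b₊ = x`) — the signs forced by `⟨∂f, g⟩_{Ω′} = ⟨f, ∂*g⟩_Ω` with `(∂f)(b) = f(b₋) − f(b₊)` (the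
print's «`σ_b(x) = +1/−1` for bonds incoming/outgoing from `x`» names the same two classes).
[cite: DybalskiStottmeisterTanimoto2024, §3.3 (adjoint)] -/
def delStar (g : Bond L n₁ → M) (x : Site L n₁) : M :=
  (∑ b : Bond L n₁, if b.src = x then g b else 0) - ∑ b : Bond L n₁, if b.tgt = x then g b else 0

/-- `(∂*g)(x) = Σ_{b₋=x} g(b) − Σ_{b₊=x} g(b)`. [cite: DybalskiStottmeisterTanimoto2024, §3.3 (adjoint)] -/
theorem delStar_apply (g : Bond L n₁ → M) (x : Site L n₁) :
    delStar g x = (∑ b : Bond L n₁, if b.src = x then g b else 0) - ∑ b : Bond L n₁, if b.tgt = x then g b else 0 := rfl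

/-- `∂` is additive. [cite: DybalskiStottmeisterTanimoto2024, §3.3 («The above definitions extend naturally to vector-valued functions»)] -/
theorem del_add (f f' : Site L n₁ → M) : del (f + f') = del f + del f' := by
  funext b; simp only [del, Pi.add_apply]; abel

/-- `∂*` is additive. [cite: DybalskiStottmeisterTanimoto2024, §3.3 (adjoint)] -/
theorem delStar_add (g g' : Bond L n₁ → M) : delStar (g + g') = delStar g + delStar g' := by
  funext x
  simp only [delStar, Pi.add_apply]
  rw [show (∑ b : Bond L n₁, if b.src = x then g b + g' b else 0) =
      (∑ b : Bond L n₁, if b.src = x then g b else 0) + ∑ b : Bond L n₁, if b.src = x then g' b else 0 by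
    rw [← Finset.sum_add_distrib]; exact Finset.sum_congr rfl fun b _ => by split_ifs <;> simp,
    show (∑ b : Bond L n₁, if b.tgt = x then g b + g' b else 0) =
      (∑ b : Bond L n₁, if b.tgt = x then g b else 0) + ∑ b : Bond L n₁, if b.tgt = x then g' b else 0 by
    rw [← Finset.sum_add_distrib]; exact Finset.sum_congr rfl fun b _ => by split_ifs <;> simp]
  abel

/-- `∂*(−g) = −∂*g`. [cite: DybalskiStottmeisterTanimoto2024, §3.3 (adjoint)] -/
theorem delStar_neg (g : Bond L n₁ → M) : delStar (-g) = -delStar g := by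
  funext x
  simp only [delStar, Pi.neg_apply]
  rw [show (∑ b : Bond L n₁, if b.src = x then -g b else 0) = -∑ b : Bond L n₁, if b.src = x then g b else 0 by
    rw [← Finset.sum_neg_distrib]; exact Finset.sum_congr rfl fun b _ => by split_ifs <;> simp,
    show (∑ b : Bond L n₁, if b.tgt = x then -g b else 0) = -∑ b : Bond L n₁, if b.tgt = x then g b else 0 by
    rw [← Finset.sum_neg_distrib]; exact Finset.sum_congr rfl fun b _ => by split_ifs <;> simp]
  abel

/-- (Laplacian) «`Δ_Ω := −∂*∂` coincides with the lattice Laplacian on `Ω` with Neumann boundary conditions».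
[cite: DybalskiStottmeisterTanimoto2024, §3.3 (Laplacian)] -/
def laplace (f : Site L n₁ → M) : Site L n₁ → M := -delStar (del f)

/-- `Δ_Ω f = −∂*∂f`. [cite: DybalskiStottmeisterTanimoto2024, §3.3 (Laplacian)] -/
theorem laplace_apply (f : Site L n₁ → M) (x : Site L n₁) : laplace f x = -delStar (del f) x := rfl

end Lattice

section Adjoint

variable {M : Type*} [NormedAddCommGroup M] [InnerProductSpace ℝ M]

/-- `⟨g, g′⟩_{Ω′} = Σ_b g(b)·g′(b)` (scalar product on bond functions). [cite: DybalskiStottmeisterTanimoto2024, Notation; §3.3 (adjoint)] -/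
def ipB (g g' : Bond L n₁ → M) : ℝ := ∑ b, ⟪g b, g' b⟫

/-- (adjoint) «`⟨∂f, g⟩_{Ω′} = ⟨f, ∂*g⟩_Ω`»: `∂*` IS the adjoint of `∂`. [cite: DybalskiStottmeisterTanimoto2024, §3.3 (adjoint)] -/
theorem ipB_del (f : Site L n₁ → M) (g : Bond L n₁ → M) : ipB (del f) g = ipS f (delStar g) := by
  unfold ipB ipS
  simp only [del_apply, delStar_apply, inner_sub_left, inner_sub_right, Finset.sum_sub_distrib, inner_sum]
  have key : ∀ (p : Bond L n₁ → Site L n₁),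
      ∑ x : Site L n₁, ∑ b : Bond L n₁, ⟪f x, if p b = x then g b else 0⟫ = ∑ b : Bond L n₁, ⟪f (p b), g b⟫ := by
    intro p
    rw [Finset.sum_comm]
    refine Finset.sum_congr rfl fun b _ => ?_
    rw [Finset.sum_eq_single (p b) (fun x _ hx => by rw [if_neg (Ne.symm hx), inner_zero_right])
      (fun h => absurd (Finset.mem_univ _) h), if_pos rfl]
  rw [key Bond.src, key Bond.tgt]

/-- (Laplacian) «`⟨f, (−Δ_Ω)f⟩ = Σ_{b∈Ω′} ⟨∂f(b), ∂f(b)⟩`». [cite: DybalskiStottmeisterTanimoto2024, §3.3 (Laplacian)] -/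
theorem ipS_neg_laplace (f : Site L n₁ → M) : ipS f (-laplace f) = ipB (del f) (del f) := by
  rw [ipB_del]
  unfold laplace
  rw [neg_neg]

end Adjoint

/-! ## (action-one-x′), Definition (W-def): `𝒜′`, `𝒲(b)`, `W⃗`, `r⃗` -/

/-- «`∂V(y_b) := V(y_{b₋})V(y_{b₊})*`» (`= 1` unless `b` crosses a block boundary). [cite: DybalskiStottmeisterTanimoto2024, §2.1 (action-one-x′); §3.3] -/
def pdV (V : CConf n₁) (b : Bond L n₁) : ℍ := (V (blk b.src)).val * star (V (blk b.tgt)).val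

/-- Definition (W-def) «`𝒲(b) := U′(b₋) ∂V(y_b) U′(b₊)*`» (`= ∂U(b)`). [cite: DybalskiStottmeisterTanimoto2024, §3.3 Definition (W-def)] -/
def Wq (U' : Conf L n₁) (V : CConf n₁) (b : Bond L n₁) : ℍ := (U' b.src).val * pdV V b * star (U' b.tgt).val

/-- (action-one-x′) «`𝒜′(U′) = Σ_{b∈Ω′} Re Tr(1 − U′(b₋)∂V(y_b)U′(b₊)*)`» (`Tr = 2Re` on `SU(2)`).
[cite: DybalskiStottmeisterTanimoto2024, §2.1 (action-one-x′); §3.3 proof of Proposition (conservation-prop)] -/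
def actionP (U' : Conf L n₁) (V : CConf n₁) : ℝ := ∑ b : Bond L n₁, 2 * (1 - (Wq U' V b).re)

/-- «We recall that `∂U(b) = U′(b₋)∂V(y_b)U′(b₊)*`»: `U(b₋)U(b₊)* = 𝒲(b)` for `U = U′V`. [cite: DybalskiStottmeisterTanimoto2024, §3.3 («We recall that `∂U(b) = U′(b₋)∂V(y_b)U′(b₊)*`»)] -/
theorem pd_val_eq_Wq (U : Conf L n₁) (V : CConf n₁) (b : Bond L n₁) : (pd U b).val = Wq (Uprime U V) V b := by
  rw [pd_val, ← Uprime_mul U V b.src, ← Uprime_mul U V b.tgt, SU2.mul_val, SU2.mul_val, star_mul, Wq, pdV]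
  simp only [mul_assoc]

/-- `𝒜(U) = 𝒜′(U′)` («The action in the new variables has the form (action-one-x′)»). [cite: DybalskiStottmeisterTanimoto2024, §2.1 (action-one-x′)] -/
theorem action_eq_actionP (U : Conf L n₁) (V : CConf n₁) : action U = actionP (Uprime U V) V := by
  unfold action actionP
  exact Finset.sum_congr rfl fun b _ => by rw [pd_val_eq_Wq U V b]

/-- `W⃗(b)`: «`𝒲(b) = δ_W𝒲₀(b) + iW⃗(b)·σ⃗` as in (Pauli-matrices-decomposition)», i.e. `W⃗(b) = vecOf 𝒲(b)`.
[cite: DybalskiStottmeisterTanimoto2024, §3.3 Definition (W-def)] -/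
def Wvec (U' : Conf L n₁) (V : CConf n₁) (b : Bond L n₁) : su2 := vecOf (Wq U' V b)

/-- `A⃗(x) = vecOf U′(x)` as a vector field on `Ω`. [cite: DybalskiStottmeisterTanimoto2024, §1.1 (Pauli-matrices-decomposition); §3.3] -/
def Avec (U' : Conf L n₁) (x : Site L n₁) : su2 := vecOf (U' x).val

/-- The remainder «`W⃗(b) =: ∂A⃗(b) + r⃗_{A⃗}(b)`», i.e. `r⃗(b) := W⃗(b) − (A⃗(b₋) − A⃗(b₊))` (explicit formula: §3.4 (terms)).
[cite: DybalskiStottmeisterTanimoto2024, §3.3 Definition (W-def), (W-def-form)] -/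
def rvec (U' : Conf L n₁) (V : CConf n₁) (b : Bond L n₁) : su2 := Wvec U' V b - del (Avec U') b

/-- (W-def-form) `W⃗ = ∂A⃗ + r⃗`. [cite: DybalskiStottmeisterTanimoto2024, §3.3 (W-def-form); §3.4 (expansion)] -/
theorem Wvec_eq_del_add_rvec (U' : Conf L n₁) (V : CConf n₁) : Wvec U' V = del (Avec U') + rvec U' V := by
  funext b
  simp only [rvec, Pi.add_apply, add_sub_cancel]

/-! ## (3.15)–(3.17): the Lie derivative of `𝒜′` -/

/-- `Re 𝒲(b) = ⟨U′(b₋)∂V(y_b), U′(b₊)⟩` (Euclidean scalar product of `ℍ`), the form in which `𝒜′` is differentiated.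
[cite: DybalskiStottmeisterTanimoto2024, §3.3 (3.15)] -/
theorem re_Wq_eq_inner (U' : Conf L n₁) (V : CConf n₁) (b : Bond L n₁) :
    (Wq U' V b).re = ⟪(U' b.src).val * pdV V b, (U' b.tgt).val⟫ := by
  rw [Quaternion.inner_def, Wq]

/-- (3.15)–(3.16): «`𝓛_X(𝒜′) = −d/dt Σ_b Re Tr(e^{itX(b₋)}U′(b₋)∂V(y_b)U′(b₊)*e^{−itX(b₊)})|_{t=0} = Σ_b Im Tr(X(b₋)𝒲(b) −
𝒲(b)X(b₊))`»: the derivative of `t ↦ 𝒜′(e^{tX}U′)` at `0` is `−2 Σ_b (Re(ξ(b₋)𝒲(b)) − Re(𝒲(b)ξ(b₊)))`.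
[cite: DybalskiStottmeisterTanimoto2024, §3.3 (3.15)–(3.16)] -/
theorem hasDerivAt_actionP_flow (X : Site L n₁ → su2) (U' : Conf L n₁) (V : CConf n₁) :
    HasDerivAt (fun t : ℝ => actionP (flow X t U') V)
      (∑ b : Bond L n₁, -2 * (((X b.src : ℍ) * Wq U' V b).re - (Wq U' V b * (X b.tgt : ℍ)).re)) 0 := by
  unfold actionP
  refine HasDerivAt.fun_sum fun b _ => ?_
  have hs := (hasDerivAt_flow_val X U' b.src 0).mul_const (pdV V b)
  have ht := hasDerivAt_flow_val X U' b.tgt 0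
  simp only [flow_zero] at hs ht
  have hW : HasDerivAt (fun t : ℝ => (Wq (flow X t U') V b).re)
      (⟪(U' b.src).val * pdV V b, (X b.tgt : ℍ) * (U' b.tgt).val⟫ +
        ⟪(X b.src : ℍ) * (U' b.src).val * pdV V b, (U' b.tgt).val⟫) 0 := by
    have h := hs.inner ℝ ht
    simp only [flow_zero] at h
    have e : (fun t : ℝ => (Wq (flow X t U') V b).re) =
        fun t : ℝ => ⟪(flow X t U' b.src).val * pdV V b, (flow X t U' b.tgt).val⟫ :=
      funext fun t => re_Wq_eq_inner _ _ _
    rw [e]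
    exact h
  have h2 := (hW.const_sub 1).const_mul (2 : ℝ)
  refine h2.congr_deriv ?_
  -- `2·(−(⟨U′₋∂V, ξ₊U′₊⟩ + ⟨ξ₋U′₋∂V, U′₊⟩)) = −2(Re(ξ₋𝒲) − Re(𝒲ξ₊))`
  have e1 : ((X b.src : ℍ) * Wq U' V b).re = ⟪(X b.src : ℍ) * (U' b.src).val * pdV V b, (U' b.tgt).val⟫ := by
    rw [Quaternion.inner_def, Wq]; simp only [mul_assoc]
  have e2 : (Wq U' V b * (X b.tgt : ℍ)).re = -⟪(U' b.src).val * pdV V b, (X b.tgt : ℍ) * (U' b.tgt).val⟫ := by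
    rw [Quaternion.inner_def, Wq, star_mul, SU2.su2_star_coe, mul_neg, mul_neg, Quaternion.re_neg, neg_neg]
    simp only [mul_assoc]
  rw [e1, e2]
  ring

/-- (3.17) «`𝓛_X(𝒜′) = 2Σ_{b∈Ω′} (∂X_k)(b)W_k(b) = 2Σ_{x∈Ω} X_k(x)(∂*W_k)(x)`» — in the flow generators `ξ = −X⃗`:
`𝓛_X 𝒜′ = −2⟨∂ξ, W⃗⟩_{Ω′}`. [cite: DybalskiStottmeisterTanimoto2024, §3.3 (3.17), (integration-by-parts)] -/
theorem lieDeriv_actionP_eq_ipB (X : Site L n₁ → su2) (U' : Conf L n₁) (V : CConf n₁) :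
    lieDeriv X (fun U'' : Conf L n₁ => actionP U'' V) U' = -2 * ipB (del X) (Wvec U' V) := by
  have h := (hasDerivAt_actionP_flow X U' V).deriv
  unfold lieDeriv
  rw [h, ipB, Finset.mul_sum]
  refine Finset.sum_congr rfl fun b _ => ?_
  rw [re_coe_mul_eq_inner, re_mul_coe_eq_inner, del_apply, inner_sub_left]
  rfl

/-- (3.17) «`= 2Σ_{x∈Ω} X_k(x)(∂*W_k)(x)`»: `𝓛_X 𝒜′ = −2⟨ξ, ∂*W⃗⟩_Ω` (the second equality «follows from (adjoint)»).
[cite: DybalskiStottmeisterTanimoto2024, §3.3 (3.17)] -/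
theorem lieDeriv_actionP (X : Site L n₁ → su2) (U' : Conf L n₁) (V : CConf n₁) :
    lieDeriv X (fun U'' : Conf L n₁ => actionP U'' V) U' = -2 * ipS X (delStar (Wvec U' V)) := by
  rw [lieDeriv_actionP_eq_ipB, ipB_del]

/-- (3.17) verbatim with `X⃗ = vecOf ξ`: `𝓛_X 𝒜′ = 2 Σ_x X⃗(x)·(∂*W⃗)(x)`. [cite: DybalskiStottmeisterTanimoto2024, §3.3 (3.17)] -/
theorem lieDeriv_actionP_vec (X : Site L n₁ → su2) (U' : Conf L n₁) (V : CConf n₁) :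
    lieDeriv X (fun U'' : Conf L n₁ => actionP U'' V) U' =
      2 * ipS (fun x => vecOf (X x : ℍ)) (delStar (Wvec U' V)) := by
  rw [lieDeriv_actionP]
  unfold ipS
  rw [neg_mul, ← mul_neg, ← Finset.sum_neg_distrib]
  congr 1
  exact Finset.sum_congr rfl fun x _ => by simp only [vecOf_coe_su2, inner_neg_left]

/-- `𝓛_X 𝒜 (U) = 𝓛_X 𝒜′ (U′)`: the Lie derivative of the action of Theorem 1 in the variables `U′`.
[cite: DybalskiStottmeisterTanimoto2024, §2.1 (action-one-x′); §3.3 (3.15)] -/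
theorem lieDeriv_action (X : Site L n₁ → su2) (U : Conf L n₁) (V : CConf n₁) :
    lieDeriv X action U = -2 * ipS X (delStar (Wvec (Uprime U V) V)) := by
  rw [← lieDeriv_actionP X (Uprime U V) V]
  unfold lieDeriv
  congr 1
  funext t
  rw [action_eq_actionP (flow X t U) V, flow_Uprime]

/-! ## Proposition (conservation-prop) and (3.14)–(3.14′) -/

/-- `Φ(x) := R̄(x)*(−∂*W⃗)(x)`, the quantity of (3.10)/(3.14) that is constant on blocks at a critical point.
[cite: DybalskiStottmeisterTanimoto2024, §3.3 Proposition (conservation-prop) (3.10), (3.14)] -/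
def Phi (U' : Conf L n₁) (V : CConf n₁) (x : Site L n₁) : su2 := RstarBar (Avec U' x) (-(delStar (Wvec U' V) x))

/-- (constraint-tangent-vectors) for two sites `x, x′`: `ξ(x) = R̄(x)v⃗`, `ξ(x′) = −R̄(x′)v⃗`, `0` elsewhere (the print takes
`(x, x′) = (c₋, c₊)` a tree bond; any two sites of one block do). [cite: DybalskiStottmeisterTanimoto2024, §3.2 (constraint-tangent-vectors)] -/
def Xpair (U' : Conf L n₁) (x x' : Site L n₁) (v : su2) : Site L n₁ → su2 :=
  fun z => (if z = x then Rbar (Avec U' x) v else 0) - (if z = x' then Rbar (Avec U' x') v else 0)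

/-- `A₀(A⃗(x)) ≠ 0` at every site of a constrained small-field configuration (so `R̄(x)` exists, «Thus `A₀(x) ≠ 0` and `R̄(x)`
above exist»). [cite: DybalskiStottmeisterTanimoto2024, §3.2 («Thus `A₀(x) ≠ 0`»)] -/
theorem A0_Avec_ne_zero (hL : 0 < L) {ε : ℝ} (hε : 0 < ε) (h1 : 4 * ch * L * ε ≤ 1) {U : Conf L n₁}
    (hU : U ∈ smallField ε) {V : CConf n₁} (hC : avg U = V) (x : Site L n₁) : A0 (Avec (Uprime U V) x) ≠ 0 := by
  have h := (vecOf_Uprime_small hL hε h1 hU hC x).2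
  unfold sgn at h
  have hpos := sign_eq_one_iff.mp h
  unfold Avec
  rw [A0_vecOf_eq_re _ hpos.le]
  exact hpos.ne'

/-- Block sums of `R(z)ξ(z)` for the pair vector: `Σ_{z∈B(y)} R(z)ξ(z) = [x∈B(y)]v⃗ − [x′∈B(y)]v⃗`.
[cite: DybalskiStottmeisterTanimoto2024, §3.2 Theorem (kernel), proof («`RD = 0`»)] -/
theorem sum_R_Xpair {U' : Conf L n₁} {x x' : Site L n₁} (hx : A0 (Avec U' x) ≠ 0) (hx' : A0 (Avec U' x') ≠ 0)
    (v : su2) (y : CSite n₁) :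
    ∑ z ∈ box L y, R (Avec U' z) (Xpair U' x x' v z) =
      (if x ∈ box L y then v else 0) - (if x' ∈ box L y then v else 0) := by
  have key : ∀ (x₀ : Site L n₁) (w : su2), ∑ z ∈ box L y, R (Avec U' z) (if z = x₀ then w else 0) =
      if x₀ ∈ box L y then R (Avec U' x₀) w else 0 := by
    intro x₀ w
    split_ifs with h
    · rw [Finset.sum_eq_single_of_mem x₀ h (fun z _ hz => by rw [if_neg hz, map_zero]), if_pos rfl]
    · exact Finset.sum_eq_zero fun z hz => by
        rw [if_neg, map_zero]
        rintro rfl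
        exact h hz
  simp only [Xpair, map_sub, Finset.sum_sub_distrib, key, R_Rbar _ hx, R_Rbar _ hx']

/-- The pair vectors are tangent («there is a three-dimensional space of vectors tangent to the constraint manifold»), for any
two sites of the same block. [cite: DybalskiStottmeisterTanimoto2024, §3.2 Theorem (kernel) (constraint-tangent-vectors)] -/
theorem isTangent_Xpair (hL : 0 < L) {ε : ℝ} (hε : 0 < ε) (h1 : 4 * ch * L * ε ≤ 1) {U : Conf L n₁}
    (hU : U ∈ smallField ε) {V : CConf n₁} (hC : avg U = V) {x x' : Site L n₁} (hxx' : blk x = blk x') (v : su2) :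
    IsTangent (Xpair (Uprime U V) x x' v) U := by
  rw [isTangent_iff' hL hε h1 hU hC]
  intro y
  have h := sum_R_Xpair (A0_Avec_ne_zero hL hε h1 hU hC x) (A0_Avec_ne_zero hL hε h1 hU hC x') v y
  simp only [Avec] at h
  rw [h]
  simp only [mem_box, hxx', sub_self]

/-- `⟨ξ_pair, g⟩_Ω = ⟨R̄(x)v, g(x)⟩ − ⟨R̄(x′)v, g(x′)⟩`. [cite: DybalskiStottmeisterTanimoto2024, §3.3 (3.12)] -/
theorem ipS_Xpair (U' : Conf L n₁) (x x' : Site L n₁) (v : su2) (g : Site L n₁ → su2) :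
    ipS (Xpair U' x x' v) g = ⟪Rbar (Avec U' x) v, g x⟫ - ⟪Rbar (Avec U' x') v, g x'⟫ := by
  unfold ipS
  simp only [Xpair, inner_sub_left, Finset.sum_sub_distrib]
  have key : ∀ (z₀ : Site L n₁) (w : su2),
      ∑ z : Site L n₁, ⟪(if z = z₀ then w else 0), g z⟫ = ⟪w, g z₀⟫ := by
    intro z₀ w
    rw [Finset.sum_eq_single z₀ (fun z _ hz => by rw [if_neg hz, inner_zero_left])
      (fun h => absurd (Finset.mem_univ _) h), if_pos rfl]
  rw [key, key]

/-- (3.12) «`𝓛_{X_c}(𝒜′) = −2v⃗_c·(R̄(c₋)*∂*W⃗(c₋) − R̄(c₊)*∂*W⃗(c₊))`» — here for the pair vector at `(x, x′)` and in terms of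
`Φ = R̄*(−∂*W⃗)`: `𝓛_{ξ_pair} 𝒜 = 2⟨v⃗, Φ(x) − Φ(x′)⟩`. [cite: DybalskiStottmeisterTanimoto2024, §3.3 (3.12)] -/
theorem lieDeriv_action_Xpair (U : Conf L n₁) (V : CConf n₁) (x x' : Site L n₁) (v : su2) :
    lieDeriv (Xpair (Uprime U V) x x' v) action U = 2 * ⟪v, Phi (Uprime U V) V x - Phi (Uprime U V) V x'⟫ := by
  rw [lieDeriv_action, ipS_Xpair, inner_Rbar_left, inner_Rbar_left, Phi, Phi, map_neg, map_neg, inner_sub_right,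
    inner_neg_right, inner_neg_right]
  ring

/-- Choice of a site in each block (the corner `Ly`), for `L > 0`. [cite: DybalskiStottmeisterTanimoto2024, §1.1 (box) («whose label `y` is the left bottom corner»)] -/
def corner (hL : 0 < L) (y : CSite n₁) : Site L n₁ := siteOf y fun _ => ⟨0, hL⟩

/-- The corner lies in its block. [cite: DybalskiStottmeisterTanimoto2024, §1.1 (box)] -/
theorem blk_corner (hL : 0 < L) (y : CSite n₁) : blk (corner hL y) = y := blk_siteOf y _

/-- **Proposition (conservation-prop)** (pairwise form).  «`A⃗` is a critical point of the action (action-one-x) in `𝔘_ε(Ω)`, with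
the constraint (constraint), if and only if we have `R̄(c₋)*∂*W⃗(c₋) = R̄(c₊)*∂*W⃗(c₊)` for any bond `c ∈ T(y)`» — equivalently
(the tree `T(y)` spans `B(y)`): iff `Φ = R̄*(−∂*W⃗)` takes one value on each block.  Regime: `4c_{1/2}Lε ≤ 1`.
[cite: DybalskiStottmeisterTanimoto2024, §3.3 Proposition (conservation-prop), (3.10)–(3.12)] -/
theorem conservation_prop (hL : 0 < L) {ε : ℝ} (hε : 0 < ε) (h1 : 4 * ch * L * ε ≤ 1) {U : Conf L n₁}
    (hU : U ∈ smallField ε) {V : CConf n₁} (hC : avg U = V) :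
    IsConstrainedCritical V U ↔
      ∀ x x' : Site L n₁, blk x = blk x' → Phi (Uprime U V) V x = Phi (Uprime U V) V x' := by
  constructor
  · rintro ⟨-, hcrit⟩ x x' hxx'
    -- test against the pair vector with `v⃗ = Φ(x) − Φ(x′)`
    have h := hcrit _ (isTangent_Xpair hL hε h1 hU hC hxx' (Phi (Uprime U V) V x - Phi (Uprime U V) V x'))
    rw [lieDeriv_action_Xpair, mul_eq_zero] at h
    rcases h with h | h
    · norm_num at h
    · exact sub_eq_zero.mp (inner_self_eq_zero.mp h)
  · intro hΦ
    refine ⟨hC, fun X hX' => ?_⟩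
    rw [isTangent_iff' hL hε h1 hU hC] at hX'
    have hX : ∀ y, ∑ z ∈ box L y, R (Avec (Uprime U V) z) (X z) = 0 := hX'
    rw [lieDeriv_action, mul_eq_zero]
    right
    -- `⟨ξ, ∂*W⃗⟩ = Σ_y ⟨Σ_{z∈B(y)} R(z)ξ(z), −Φ(corner y)⟩ = 0`
    unfold ipS
    rw [sum_eq_sum_box]
    refine Finset.sum_eq_zero fun y _ => ?_
    have hW : ∀ z ∈ box L y, delStar (Wvec (Uprime U V) V) z = -Rstar (Avec (Uprime U V) z) (Phi (Uprime U V) V (corner hL y)) := by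
      intro z hz
      rw [← hΦ z (corner hL y) (by rw [blk_corner, mem_box.mp hz]), Phi,
        Rstar_RstarBar _ (A0_Avec_ne_zero hL hε h1 hU hC z), neg_neg]
    calc ∑ z ∈ box L y, ⟪X z, delStar (Wvec (Uprime U V) V) z⟫
        = ∑ z ∈ box L y, -⟪R (Avec (Uprime U V) z) (X z), Phi (Uprime U V) V (corner hL y)⟫ :=
          Finset.sum_congr rfl fun z hz => by rw [hW z hz, inner_neg_right, inner_R_left]
      _ = -⟪∑ z ∈ box L y, R (Avec (Uprime U V) z) (X z), Phi (Uprime U V) V (corner hL y)⟫ := by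
          rw [sum_inner, Finset.sum_neg_distrib]
      _ = 0 := by rw [hX y, inner_zero_left, neg_zero]

/-- (3.10) as printed, for every bond inside a block (in particular for the bonds of any spanning tree `T(y)` of `B(y)`):
at a constrained critical point `R̄(c₋)*∂*W⃗(c₋) = R̄(c₊)*∂*W⃗(c₊)`. [cite: DybalskiStottmeisterTanimoto2024, §3.3 Proposition (conservation-prop) (3.10)] -/
theorem conservation_on_block_bonds (hL : 0 < L) {ε : ℝ} (hε : 0 < ε) (h1 : 4 * ch * L * ε ≤ 1) {U : Conf L n₁}
    (hU : U ∈ smallField ε) {V : CConf n₁} (hC : avg U = V) (hcrit : IsConstrainedCritical V U) (c : Bond L n₁)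
    (hc : blk c.src = blk c.tgt) :
    RstarBar (Avec (Uprime U V) c.src) (delStar (Wvec (Uprime U V) V) c.src) =
      RstarBar (Avec (Uprime U V) c.tgt) (delStar (Wvec (Uprime U V) V) c.tgt) := by
  have h := (conservation_prop hL hε h1 hU hC).mp hcrit c.src c.tgt hc
  simp only [Phi, map_neg, neg_inj] at h
  exact h

/-- (3.14) ⇔ (3.14′): critical iff «for some block-constant family of vectors `C⃗(y_x)`» one has `−(∂*W⃗)(x) = R(x)*C⃗(y_x)` for
all `x` (the print's (3.14) `R̄(x)*(−∂*W⃗)(x) = C⃗(y_x)` multiplied by `R(x)*`). [cite: DybalskiStottmeisterTanimoto2024, §3.3 (3.14), proof of Theorem (critical-point-equation)] -/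
theorem critical_iff_exists_blockConst (hL : 0 < L) {ε : ℝ} (hε : 0 < ε) (h1 : 4 * ch * L * ε ≤ 1) {U : Conf L n₁}
    (hU : U ∈ smallField ε) {V : CConf n₁} (hC : avg U = V) :
    IsConstrainedCritical V U ↔
      ∃ C : CSite n₁ → su2, ∀ x, -(delStar (Wvec (Uprime U V) V) x) = Rstar (Avec (Uprime U V) x) (C (blk x)) := by
  rw [conservation_prop hL hε h1 hU hC]
  constructor
  · intro hΦ
    refine ⟨fun y => Phi (Uprime U V) V (corner hL y), fun x => ?_⟩
    dsimp only
    rw [← hΦ x (corner hL (blk x)) (by rw [blk_corner]), Phi, Rstar_RstarBar _ (A0_Avec_ne_zero hL hε h1 hU hC x)]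
  · rintro ⟨C, hCeq⟩ x x' hxx'
    rw [Phi, Phi, hCeq x, hCeq x', RstarBar_Rstar _ (A0_Avec_ne_zero hL hε h1 hU hC x),
      RstarBar_Rstar _ (A0_Avec_ne_zero hL hε h1 hU hC x'), hxx']

/-- `−∂*W⃗ = Δ_Ω A⃗ − ∂*r⃗` («where we used (W-def-form)»: `W⃗ = ∂A⃗ + r⃗`, `Δ_Ω = −∂*∂`).
[cite: DybalskiStottmeisterTanimoto2024, §3.3 proof of Theorem (critical-point-equation), (second-equation-critical)] -/
theorem neg_delStar_Wvec (U' : Conf L n₁) (V : CConf n₁) (x : Site L n₁) :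
    -(delStar (Wvec U' V) x) = laplace (Avec U') x - delStar (rvec U' V) x := by
  rw [Wvec_eq_del_add_rvec, delStar_add, Pi.add_apply, laplace_apply, neg_add, sub_eq_add_neg]

/-- (second-equation-critical) «`(Δ_Ω A⃗)(x) − (∂*r⃗)(x) = R(x)*C⃗(y_x)`» for some block-constant `C⃗`, iff `U = U′V` is a
constrained critical point (regime `4c_{1/2}Lε ≤ 1`). [cite: DybalskiStottmeisterTanimoto2024, §3.3 (second-equation-critical)] -/
theorem second_equation_critical (hL : 0 < L) {ε : ℝ} (hε : 0 < ε) (h1 : 4 * ch * L * ε ≤ 1) {U : Conf L n₁}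
    (hU : U ∈ smallField ε) {V : CConf n₁} (hC : avg U = V) :
    IsConstrainedCritical V U ↔ ∃ C : CSite n₁ → su2, ∀ x,
      laplace (Avec (Uprime U V)) x - delStar (rvec (Uprime U V) V) x = Rstar (Avec (Uprime U V) x) (C (blk x)) := by
  rw [critical_iff_exists_blockConst hL hε h1 hU hC]
  simp only [neg_delStar_Wvec]

/-- «As we checked in Section (simplification), the constraint has the form `Q(A⃗) = 0`» (regime `4c_{1/2}Lε ≤ 1`, where
`δ = 1`). [cite: DybalskiStottmeisterTanimoto2024, §2.1 (2.4)–(2.5); §3.3 proof of Theorem (critical-point-equation)] -/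
theorem Q_Avec_eq_zero (hL : 0 < L) {ε : ℝ} (hε : 0 < ε) (h1 : 4 * ch * L * ε ≤ 1) {U : Conf L n₁}
    (hU : U ∈ smallField ε) {V : CConf n₁} (hC : avg U = V) : Q L (Avec (Uprime U V)) = 0 := by
  funext y
  rw [Pi.zero_apply, Q_eq_zero_iff hL]
  exact sum_vecOf_eq_zero_of_constraint hL (C0_ne_zero hL hε.le (eps_le_of_regime hL hε.le h1) hU y) (congrFun hC y)

end

end Literature.MathematicalPhysics.QuantumFieldTheory.DybalskiStottmeisterTanimoto2024.DST24CriticalPoint
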